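import Summits.CriticalPhenomena.PercolationContinuityZ3.Theorems.Transplant.FKDoubleFanOneSided
import HarnessLib

/-!
# Double fans, MULTIFAN₁ middles: the certificate for the CORE-sized endpoint polynomial `𝒞₂` of LEMMA‴, part B

Helper file (`--supports stmt-CriticalPhenomena-4575`), FK sub-lane `prim-bschramm-fk-3` (gen 34); builds on p205010 (kernel theorem, internal audit
signed; external expert review pending).  Pure real polynomial algebra, no sorries; standard axioms.  Memo `bschramm/prim-bschramm-fk-3/FAR-CROSS-IX.md` §6–§6g.

Context.  `…DoubleFanMultifan` reduces cross-apex negative correlation across every middle whose `a`-spokes precede its `b`-spokes (every distance, every weighted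
double fan, `0 < q ≤ 1`) to the four-leg inequality LEMMA‴ on `InKE⁴`; the leg reductions (`…DoubleFanMultifanForm`, gen 32's `vecB_nonneg_of_rays_gen`) leave 324
endpoint cells of which all but three polynomials are zero, tensor-Bernstein or closed forms (memo §6).  The floor-`a`-fan × three-roofs cell decomposes as
`𝒜·Z_f(Z_f+r_f+X_f) + 𝒩·X_f(X_f+r_f+Z_f) + 𝒞₁·Z_f y_f + 𝒞₂·X_f y_f` with `𝒜` = gen 33's CORE (`fanCore_holds`); this file and its companions certify
**`𝒞₂ ≥ 0`** on `t ≥ 0`, `q, w ∈ [0,1]`: with `α = t_s w_g + t_u(w_g − w_s)`, `m₂ = w_g(1−w_s)(1−w_u)`,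
  `𝒞₂ = 4(1−q)²·[(α + m₂)² + q·t_g·α²] + Σ_e t_g^{e₁} t_u^{e₂} t_s^{e₃} · R_e(q, w_g, w_u, w_s)`  (twenty exponents `e`),
and every `R_e ≥ 0` on `[0,1]⁴` by an explicit certificate: a tensor-Bernstein expansion with non-negative coefficients, or `(w−w′)²`-multiples of such plus such
(found by linear programming at zero slack, rationalised, verified exactly), or the closed form `R₁₂₁ = q²(1−q)(2−q)·H(w_g,w_s)`,
`H(w,w′) = (2−q)(w−w′)² + 2q w w′(1−w)(1−w′)`.  This file: the coefficients `mfCtwoR011`, `mfCtwoR012`, `mfCtwoR020`, `mfCtwoR021`, `mfCtwoR100`, `mfCtwoR101`, `mfCtwoR102` and their non-negativity lemmas.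
[folklore]
-/

noncomputable section

namespace Summit.CriticalPhenomena.PercolationContinuityZ3.Theorems

namespace FK

namespace ThreeApex

/-- Remainder coefficient of `t_g^0 t_u^1 t_s^1` in the `C2` certificate (polynomial in `q, wg, wu, ws`). [folklore] -/
def mfCtwoR011 (q wg wu ws : ℝ) : ℝ :=
  ((-1) : ℝ) * q ^ 4 * wg ^ 2 * ws ^ 2 * wu ^ 2 + (6 : ℝ) * q ^ 3 * wg ^ 2 * ws ^ 2 * wu ^ 2 + ((-8) : ℝ) * q ^ 2 * wg ^ 2 * ws ^ 2 * wu ^ 2 +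
    ((-2) : ℝ) * q ^ 3 * wg * ws ^ 2 * wu ^ 2 + ((-2) : ℝ) * q ^ 3 * wg ^ 2 * ws * wu ^ 2 + (1 : ℝ) * q ^ 4 * wg ^ 2 * ws ^ 2 + (1 : ℝ) * q ^ 4 * wg ^ 2 * wu ^ 2 +
    (1 : ℝ) * q ^ 4 * ws ^ 2 * wu ^ 2 + (4 : ℝ) * q ^ 2 * wg * ws ^ 2 * wu ^ 2 + (4 : ℝ) * q ^ 2 * wg ^ 2 * ws * wu ^ 2 + (4 : ℝ) * q ^ 3 * wg * ws * wu ^ 2 +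
    ((-3) : ℝ) * q ^ 3 * wg ^ 2 * ws ^ 2 + ((-4) : ℝ) * q ^ 3 * wg ^ 2 * wu ^ 2 + ((-5) : ℝ) * q ^ 3 * ws ^ 2 * wu ^ 2 + ((-12) : ℝ) * q ^ 2 * wg * ws * wu ^ 2 +
    (2 : ℝ) * q ^ 2 * wg ^ 2 * ws ^ 2 + (4 : ℝ) * q ^ 2 * wg ^ 2 * wu ^ 2 + (8 : ℝ) * q ^ 2 * ws ^ 2 * wu ^ 2 + ((-2) : ℝ) * q ^ 3 * wg * ws ^ 2 + ((-2) : ℝ) * q ^ 3 * wg ^ 2 * ws +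
    ((-1) : ℝ) * q ^ 4 * wg ^ 2 + ((-1) : ℝ) * q ^ 4 * ws ^ 2 + (8 : ℝ) * q * wg * ws * wu ^ 2 + ((-4) : ℝ) * q * ws ^ 2 * wu ^ 2 + (6 : ℝ) * q ^ 2 * wg * ws ^ 2 +
    (6 : ℝ) * q ^ 2 * wg ^ 2 * ws + (4 : ℝ) * q ^ 3 * wg * ws + (3 : ℝ) * q ^ 3 * wg ^ 2 + (5 : ℝ) * q ^ 3 * ws ^ 2 + ((-4) : ℝ) * q * wg * ws ^ 2 + ((-4) : ℝ) * q * wg ^ 2 * ws +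
    ((-8) : ℝ) * q ^ 2 * wg * ws + ((-6) : ℝ) * q ^ 2 * wg ^ 2 + ((-8) : ℝ) * q ^ 2 * ws ^ 2 + (4 : ℝ) * q * wg * ws + (4 : ℝ) * q * wg ^ 2 + (4 : ℝ) * q * ws ^ 2

/-- Remainder coefficient of `t_g^0 t_u^1 t_s^2` in the `C2` certificate (polynomial in `q, wg, wu`). [folklore] -/
def mfCtwoR012 (q wg wu : ℝ) : ℝ :=
  (1 : ℝ) * q ^ 4 * wg ^ 2 * wu ^ 2 + ((-4) : ℝ) * q ^ 3 * wg ^ 2 * wu ^ 2 + (4 : ℝ) * q ^ 2 * wg ^ 2 * wu ^ 2 + ((-1) : ℝ) * q ^ 4 * wg ^ 2 + (5 : ℝ) * q ^ 3 * wg ^ 2 +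
    ((-8) : ℝ) * q ^ 2 * wg ^ 2 + (4 : ℝ) * q * wg ^ 2

/-- Remainder coefficient of `t_g^0 t_u^2 t_s^0` in the `C2` certificate (polynomial in `q, wg, ws`). [folklore] -/
def mfCtwoR020 (q wg ws : ℝ) : ℝ :=
  (2 : ℝ) * q ^ 3 * wg ^ 2 * ws ^ 2 + ((-6) : ℝ) * q ^ 2 * wg ^ 2 * ws ^ 2 + ((-2) : ℝ) * q ^ 3 * wg * ws ^ 2 + ((-2) : ℝ) * q ^ 3 * wg ^ 2 * ws + (4 : ℝ) * q * wg ^ 2 * ws ^ 2 +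
    (6 : ℝ) * q ^ 2 * wg * ws ^ 2 + (6 : ℝ) * q ^ 2 * wg ^ 2 * ws + (4 : ℝ) * q ^ 3 * wg * ws + ((-1) : ℝ) * q ^ 3 * wg ^ 2 + ((-1) : ℝ) * q ^ 3 * ws ^ 2 +
    ((-4) : ℝ) * q * wg * ws ^ 2 + ((-4) : ℝ) * q * wg ^ 2 * ws + ((-8) : ℝ) * q ^ 2 * wg * ws + (1 : ℝ) * q ^ 2 * wg ^ 2 + (1 : ℝ) * q ^ 2 * ws ^ 2 + (4 : ℝ) * q * wg * ws

/-- Remainder coefficient of `t_g^0 t_u^2 t_s^1` in the `C2` certificate (polynomial in `q, wg, ws`). [folklore] -/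
def mfCtwoR021 (q wg ws : ℝ) : ℝ :=
  (2 : ℝ) * q ^ 4 * wg ^ 2 * ws ^ 2 + ((-6) : ℝ) * q ^ 3 * wg ^ 2 * ws ^ 2 + ((-2) : ℝ) * q ^ 4 * wg * ws ^ 2 + ((-2) : ℝ) * q ^ 4 * wg ^ 2 * ws + (4 : ℝ) * q ^ 2 * wg ^ 2 * ws ^ 2 +
    (6 : ℝ) * q ^ 3 * wg * ws ^ 2 + (6 : ℝ) * q ^ 3 * wg ^ 2 * ws + (4 : ℝ) * q ^ 4 * wg * ws + ((-1) : ℝ) * q ^ 4 * wg ^ 2 + ((-1) : ℝ) * q ^ 4 * ws ^ 2 +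
    ((-4) : ℝ) * q ^ 2 * wg * ws ^ 2 + ((-4) : ℝ) * q ^ 2 * wg ^ 2 * ws + ((-16) : ℝ) * q ^ 3 * wg * ws + (5 : ℝ) * q ^ 3 * wg ^ 2 + (5 : ℝ) * q ^ 3 * ws ^ 2 +
    (20 : ℝ) * q ^ 2 * wg * ws + ((-8) : ℝ) * q ^ 2 * wg ^ 2 + ((-8) : ℝ) * q ^ 2 * ws ^ 2 + ((-8) : ℝ) * q * wg * ws + (4 : ℝ) * q * wg ^ 2 + (4 : ℝ) * q * ws ^ 2

/-- Remainder coefficient of `t_g^1 t_u^0 t_s^0` in the `C2` certificate (polynomial in `q, wg, wu, ws`). [folklore] -/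
def mfCtwoR100 (q wg wu ws : ℝ) : ℝ :=
  ((-1) : ℝ) * q ^ 4 * wg ^ 2 * ws ^ 2 * wu ^ 2 + (6 : ℝ) * q ^ 3 * wg ^ 2 * ws ^ 2 * wu ^ 2 + ((-8) : ℝ) * q ^ 2 * wg ^ 2 * ws ^ 2 * wu ^ 2 +
    ((-2) : ℝ) * q ^ 3 * wg * ws ^ 2 * wu ^ 2 + ((-2) : ℝ) * q ^ 3 * wg ^ 2 * ws * wu ^ 2 + (1 : ℝ) * q ^ 4 * wg ^ 2 * ws ^ 2 + (1 : ℝ) * q ^ 4 * wg ^ 2 * wu ^ 2 +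
    (4 : ℝ) * q ^ 2 * wg * ws ^ 2 * wu ^ 2 + (4 : ℝ) * q ^ 2 * wg ^ 2 * ws * wu ^ 2 + (4 : ℝ) * q ^ 3 * wg * ws * wu ^ 2 + ((-5) : ℝ) * q ^ 3 * wg ^ 2 * ws ^ 2 +
    ((-5) : ℝ) * q ^ 3 * wg ^ 2 * wu ^ 2 + ((-12) : ℝ) * q ^ 2 * wg * ws * wu ^ 2 + (8 : ℝ) * q ^ 2 * wg ^ 2 * ws ^ 2 + (8 : ℝ) * q ^ 2 * wg ^ 2 * wu ^ 2 +
    (1 : ℝ) * q ^ 2 * ws ^ 2 * wu ^ 2 + ((-1) : ℝ) * q ^ 4 * wg ^ 2 + (8 : ℝ) * q * wg * ws * wu ^ 2 + ((-4) : ℝ) * q * wg ^ 2 * ws ^ 2 + ((-4) : ℝ) * q * wg ^ 2 * wu ^ 2 +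
    ((-4) : ℝ) * q * ws ^ 2 * wu ^ 2 + (5 : ℝ) * q ^ 3 * wg ^ 2 + ((-8) : ℝ) * q ^ 2 * wg ^ 2 + (4 : ℝ) * ws ^ 2 * wu ^ 2 + (4 : ℝ) * q * wg ^ 2

/-- Remainder coefficient of `t_g^1 t_u^0 t_s^1` in the `C2` certificate (polynomial in `q, wg, wu, ws`). [folklore] -/
def mfCtwoR101 (q wg wu ws : ℝ) : ℝ :=
  ((-1) : ℝ) * q ^ 4 * wg ^ 2 * ws ^ 2 * wu ^ 2 + (6 : ℝ) * q ^ 3 * wg ^ 2 * ws ^ 2 * wu ^ 2 + ((-8) : ℝ) * q ^ 2 * wg ^ 2 * ws ^ 2 * wu ^ 2 +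
    ((-2) : ℝ) * q ^ 3 * wg * ws ^ 2 * wu ^ 2 + ((-2) : ℝ) * q ^ 3 * wg ^ 2 * ws * wu ^ 2 + (1 : ℝ) * q ^ 4 * wg ^ 2 * ws ^ 2 + (2 : ℝ) * q ^ 4 * wg ^ 2 * wu ^ 2 +
    (4 : ℝ) * q ^ 2 * wg * ws ^ 2 * wu ^ 2 + (4 : ℝ) * q ^ 2 * wg ^ 2 * ws * wu ^ 2 + (4 : ℝ) * q ^ 3 * wg * ws * wu ^ 2 + ((-5) : ℝ) * q ^ 3 * wg ^ 2 * ws ^ 2 +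
    ((-9) : ℝ) * q ^ 3 * wg ^ 2 * wu ^ 2 + (1 : ℝ) * q ^ 3 * ws ^ 2 * wu ^ 2 + ((-12) : ℝ) * q ^ 2 * wg * ws * wu ^ 2 + (8 : ℝ) * q ^ 2 * wg ^ 2 * ws ^ 2 +
    (12 : ℝ) * q ^ 2 * wg ^ 2 * wu ^ 2 + ((-4) : ℝ) * q ^ 2 * ws ^ 2 * wu ^ 2 + ((-2) : ℝ) * q ^ 4 * wg ^ 2 + (8 : ℝ) * q * wg * ws * wu ^ 2 + ((-4) : ℝ) * q * wg ^ 2 * ws ^ 2 +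
    ((-4) : ℝ) * q * wg ^ 2 * wu ^ 2 + (4 : ℝ) * q * ws ^ 2 * wu ^ 2 + (10 : ℝ) * q ^ 3 * wg ^ 2 + ((-16) : ℝ) * q ^ 2 * wg ^ 2 + (8 : ℝ) * q * wg ^ 2

/-- Remainder coefficient of `t_g^1 t_u^0 t_s^2` in the `C2` certificate (polynomial in `q, wg, wu`). [folklore] -/
def mfCtwoR102 (q wg wu : ℝ) : ℝ :=
  (1 : ℝ) * q ^ 4 * wg ^ 2 * wu ^ 2 + ((-4) : ℝ) * q ^ 3 * wg ^ 2 * wu ^ 2 + (4 : ℝ) * q ^ 2 * wg ^ 2 * wu ^ 2 + ((-1) : ℝ) * q ^ 4 * wg ^ 2 + (1 : ℝ) * q ^ 3 * wg ^ 2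


set_option maxRecDepth 20000 in
set_option maxHeartbeats 4000000 in
/-- `mfCtwoR011 ≥ 0` on the box `q, w_g, w_u, w_s ∈ [0,1]` (explicit non-negative certificate, checked by `ring` + `positivity`). [folklore] -/
theorem mfCtwoR011_nonneg {q wg wu ws : ℝ} (hq0 : 0 ≤ q) (hq1 : q ≤ 1) (hwg0 : 0 ≤ wg) (hwg1 : wg ≤ 1) (hwu0 : 0 ≤ wu) (hwu1 : wu ≤ 1) (hws0 : 0 ≤ ws) (hws1 : ws ≤ 1) : 0 ≤ mfCtwoR011 q wg wu ws := by
  have hq1' : (0:ℝ) ≤ 1 - q := sub_nonneg.2 hq1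
  have hwg1' : (0:ℝ) ≤ 1 - wg := sub_nonneg.2 hwg1
  have hwu1' : (0:ℝ) ≤ 1 - wu := sub_nonneg.2 hwu1
  have hws1' : (0:ℝ) ≤ 1 - ws := sub_nonneg.2 hws1
  have e : mfCtwoR011 q wg wu ws =
      (4 : ℝ) * q * (1 - q) ^ 3 * (1 - wg) ^ 2 * (1 - wu) ^ 2 * ws ^ 2 + (8 : ℝ) * q * (1 - q) ^ 3 * (1 - wg) ^ 2 * wu * (1 - wu) * ws ^ 2 +
      (4 : ℝ) * q * (1 - q) ^ 3 * wg * (1 - wg) * (1 - wu) ^ 2 * ws * (1 - ws) + (8 : ℝ) * q * (1 - q) ^ 3 * wg * (1 - wg) * (1 - wu) ^ 2 * ws ^ 2 +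
      (8 : ℝ) * q * (1 - q) ^ 3 * wg * (1 - wg) * wu * (1 - wu) * ws * (1 - ws) + (16 : ℝ) * q * (1 - q) ^ 3 * wg * (1 - wg) * wu * (1 - wu) * ws ^ 2 +
      (12 : ℝ) * q * (1 - q) ^ 3 * wg * (1 - wg) * wu ^ 2 * ws * (1 - ws) + (8 : ℝ) * q * (1 - q) ^ 3 * wg * (1 - wg) * wu ^ 2 * ws ^ 2 +
      (4 : ℝ) * q * (1 - q) ^ 3 * wg ^ 2 * (1 - wu) ^ 2 * (1 - ws) ^ 2 + (8 : ℝ) * q * (1 - q) ^ 3 * wg ^ 2 * (1 - wu) ^ 2 * ws * (1 - ws) +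
      (4 : ℝ) * q * (1 - q) ^ 3 * wg ^ 2 * (1 - wu) ^ 2 * ws ^ 2 + (8 : ℝ) * q * (1 - q) ^ 3 * wg ^ 2 * wu * (1 - wu) * (1 - ws) ^ 2 +
      (16 : ℝ) * q * (1 - q) ^ 3 * wg ^ 2 * wu * (1 - wu) * ws * (1 - ws) + (8 : ℝ) * q * (1 - q) ^ 3 * wg ^ 2 * wu * (1 - wu) * ws ^ 2 +
      (4 : ℝ) * q * (1 - q) ^ 3 * wg ^ 2 * wu ^ 2 * (1 - ws) ^ 2 + (16 : ℝ) * q * (1 - q) ^ 3 * wg ^ 2 * wu ^ 2 * ws * (1 - ws) +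
      (8 : ℝ) * q * (1 - q) ^ 3 * wg ^ 2 * wu ^ 2 * ws ^ 2 + (4 : ℝ) * q ^ 2 * (1 - q) ^ 2 * (1 - wg) ^ 2 * (1 - wu) ^ 2 * ws ^ 2 +
      (8 : ℝ) * q ^ 2 * (1 - q) ^ 2 * (1 - wg) ^ 2 * wu * (1 - wu) * ws ^ 2 + (4 : ℝ) * q ^ 2 * (1 - q) ^ 2 * wg * (1 - wg) * (1 - wu) ^ 2 * ws * (1 - ws) +
      (6 : ℝ) * q ^ 2 * (1 - q) ^ 2 * wg * (1 - wg) * (1 - wu) ^ 2 * ws ^ 2 + (8 : ℝ) * q ^ 2 * (1 - q) ^ 2 * wg * (1 - wg) * wu * (1 - wu) * ws * (1 - ws) +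
      (12 : ℝ) * q ^ 2 * (1 - q) ^ 2 * wg * (1 - wg) * wu * (1 - wu) * ws ^ 2 + (16 : ℝ) * q ^ 2 * (1 - q) ^ 2 * wg * (1 - wg) * wu ^ 2 * ws * (1 - ws) +
      (14 : ℝ) * q ^ 2 * (1 - q) ^ 2 * wg * (1 - wg) * wu ^ 2 * ws ^ 2 + (6 : ℝ) * q ^ 2 * (1 - q) ^ 2 * wg ^ 2 * (1 - wu) ^ 2 * (1 - ws) ^ 2 +
      (10 : ℝ) * q ^ 2 * (1 - q) ^ 2 * wg ^ 2 * (1 - wu) ^ 2 * ws * (1 - ws) + (4 : ℝ) * q ^ 2 * (1 - q) ^ 2 * wg ^ 2 * (1 - wu) ^ 2 * ws ^ 2 +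
      (12 : ℝ) * q ^ 2 * (1 - q) ^ 2 * wg ^ 2 * wu * (1 - wu) * (1 - ws) ^ 2 + (20 : ℝ) * q ^ 2 * (1 - q) ^ 2 * wg ^ 2 * wu * (1 - wu) * ws * (1 - ws) +
      (8 : ℝ) * q ^ 2 * (1 - q) ^ 2 * wg ^ 2 * wu * (1 - wu) * ws ^ 2 + (10 : ℝ) * q ^ 2 * (1 - q) ^ 2 * wg ^ 2 * wu ^ 2 * (1 - ws) ^ 2 +
      (34 : ℝ) * q ^ 2 * (1 - q) ^ 2 * wg ^ 2 * wu ^ 2 * ws * (1 - ws) + (16 : ℝ) * q ^ 2 * (1 - q) ^ 2 * wg ^ 2 * wu ^ 2 * ws ^ 2 +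
      (1 : ℝ) * q ^ 3 * (1 - q) * (1 - wg) ^ 2 * (1 - wu) ^ 2 * ws ^ 2 + (2 : ℝ) * q ^ 3 * (1 - q) * (1 - wg) ^ 2 * wu * (1 - wu) * ws ^ 2 +
      (4 : ℝ) * q ^ 3 * (1 - q) * wg * (1 - wg) * wu ^ 2 * ws * (1 - ws) + (8 : ℝ) * q ^ 3 * (1 - q) * wg * (1 - wg) * wu ^ 2 * ws ^ 2 +
      (3 : ℝ) * q ^ 3 * (1 - q) * wg ^ 2 * (1 - wu) ^ 2 * (1 - ws) ^ 2 + (4 : ℝ) * q ^ 3 * (1 - q) * wg ^ 2 * (1 - wu) ^ 2 * ws * (1 - ws) +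
      (1 : ℝ) * q ^ 3 * (1 - q) * wg ^ 2 * (1 - wu) ^ 2 * ws ^ 2 + (6 : ℝ) * q ^ 3 * (1 - q) * wg ^ 2 * wu * (1 - wu) * (1 - ws) ^ 2 +
      (8 : ℝ) * q ^ 3 * (1 - q) * wg ^ 2 * wu * (1 - wu) * ws * (1 - ws) + (2 : ℝ) * q ^ 3 * (1 - q) * wg ^ 2 * wu * (1 - wu) * ws ^ 2 +
      (7 : ℝ) * q ^ 3 * (1 - q) * wg ^ 2 * wu ^ 2 * (1 - ws) ^ 2 + (22 : ℝ) * q ^ 3 * (1 - q) * wg ^ 2 * wu ^ 2 * ws * (1 - ws) +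
      (10 : ℝ) * q ^ 3 * (1 - q) * wg ^ 2 * wu ^ 2 * ws ^ 2 + (2 : ℝ) * q ^ 4 * wg * (1 - wg) * wu ^ 2 * ws ^ 2 + (1 : ℝ) * q ^ 4 * wg ^ 2 * wu ^ 2 * (1 - ws) ^ 2 +
      (4 : ℝ) * q ^ 4 * wg ^ 2 * wu ^ 2 * ws * (1 - ws) + (2 : ℝ) * q ^ 4 * wg ^ 2 * wu ^ 2 * ws ^ 2 := by
    simp only [mfCtwoR011]; ring
  rw [e]; positivity

set_option maxHeartbeats 1500000 in
/-- `mfCtwoR012 ≥ 0` on the box `q, w_g, w_u, w_s ∈ [0,1]` (explicit non-negative certificate, checked by `ring` + `positivity`). [folklore] -/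
theorem mfCtwoR012_nonneg {q wg wu : ℝ} (hq0 : 0 ≤ q) (hq1 : q ≤ 1) (hwu0 : 0 ≤ wu) (hwu1 : wu ≤ 1) : 0 ≤ mfCtwoR012 q wg wu := by
  have hq1' : (0:ℝ) ≤ 1 - q := sub_nonneg.2 hq1
  have hwu1' : (0:ℝ) ≤ 1 - wu := sub_nonneg.2 hwu1
  have e : mfCtwoR012 q wg wu =
      (4 : ℝ) * q * (1 - q) ^ 3 * wg ^ 2 * (1 - wu) ^ 2 + (8 : ℝ) * q * (1 - q) ^ 3 * wg ^ 2 * wu * (1 - wu) + (4 : ℝ) * q * (1 - q) ^ 3 * wg ^ 2 * wu ^ 2 +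
      (4 : ℝ) * q ^ 2 * (1 - q) ^ 2 * wg ^ 2 * (1 - wu) ^ 2 + (8 : ℝ) * q ^ 2 * (1 - q) ^ 2 * wg ^ 2 * wu * (1 - wu) + (8 : ℝ) * q ^ 2 * (1 - q) ^ 2 * wg ^ 2 * wu ^ 2 +
      (1 : ℝ) * q ^ 3 * (1 - q) * wg ^ 2 * (1 - wu) ^ 2 + (2 : ℝ) * q ^ 3 * (1 - q) * wg ^ 2 * wu * (1 - wu) + (5 : ℝ) * q ^ 3 * (1 - q) * wg ^ 2 * wu ^ 2 +
      (1 : ℝ) * q ^ 4 * wg ^ 2 * wu ^ 2 := by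
    simp only [mfCtwoR012]; ring
  rw [e]; positivity

set_option maxHeartbeats 1500000 in
/-- `mfCtwoR020 ≥ 0` on the box `q, w_g, w_u, w_s ∈ [0,1]` (explicit non-negative certificate, checked by `ring` + `positivity`). [folklore] -/
theorem mfCtwoR020_nonneg {q wg ws : ℝ} (hq0 : 0 ≤ q) (hq1 : q ≤ 1) (hwg0 : 0 ≤ wg) (hwg1 : wg ≤ 1) (hws0 : 0 ≤ ws) (hws1 : ws ≤ 1) : 0 ≤ mfCtwoR020 q wg ws := by
  have hq1' : (0:ℝ) ≤ 1 - q := sub_nonneg.2 hq1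
  have hwg1' : (0:ℝ) ≤ 1 - wg := sub_nonneg.2 hwg1
  have hws1' : (0:ℝ) ≤ 1 - ws := sub_nonneg.2 hws1
  have e : mfCtwoR020 q wg ws =
      (4 : ℝ) * q * (1 - q) ^ 2 * wg * (1 - wg) * ws * (1 - ws) + (1 : ℝ) * q ^ 2 * (1 - q) * (1 - wg) ^ 2 * ws ^ 2 + (1 : ℝ) * q ^ 2 * (1 - q) * wg ^ 2 * (1 - ws) ^ 2 := by
    simp only [mfCtwoR020]; ring
  rw [e]; positivity

set_option maxHeartbeats 1500000 in
/-- `mfCtwoR021 ≥ 0` on the box `q, w_g, w_u, w_s ∈ [0,1]` (explicit non-negative certificate, checked by `ring` + `positivity`). [folklore] -/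
theorem mfCtwoR021_nonneg {q wg ws : ℝ} (hq0 : 0 ≤ q) (hq1 : q ≤ 1) (hwg0 : 0 ≤ wg) (hwg1 : wg ≤ 1) (hws0 : 0 ≤ ws) (hws1 : ws ≤ 1) : 0 ≤ mfCtwoR021 q wg ws := by
  have hq1' : (0:ℝ) ≤ 1 - q := sub_nonneg.2 hq1
  have hwg1' : (0:ℝ) ≤ 1 - wg := sub_nonneg.2 hwg1
  have hws1' : (0:ℝ) ≤ 1 - ws := sub_nonneg.2 hws1
  have e : mfCtwoR021 q wg ws =
      (4 : ℝ) * (wg - ws) ^ 2 * q * (1 - q) ^ 2 * (1:ℝ) + (4 : ℝ) * (wg - ws) ^ 2 * q * (1 - q) ^ 2 * (0:ℝ) + (4 : ℝ) * q ^ 2 * (1 - q) ^ 2 * wg * (1 - wg) * ws * (1 - ws) +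
      (1 : ℝ) * q ^ 3 * (1 - q) * (1 - wg) ^ 2 * ws ^ 2 + (1 : ℝ) * q ^ 3 * (1 - q) * wg ^ 2 * (1 - ws) ^ 2 := by
    simp only [mfCtwoR021]; ring
  rw [e]; positivity

set_option maxHeartbeats 1500000 in
/-- `mfCtwoR100 ≥ 0` on the box `q, w_g, w_u, w_s ∈ [0,1]` (explicit non-negative certificate, checked by `ring` + `positivity`). [folklore] -/
theorem mfCtwoR100_nonneg {q wg wu ws : ℝ} (hq0 : 0 ≤ q) (hq1 : q ≤ 1) (hwg0 : 0 ≤ wg) (hwg1 : wg ≤ 1) (hwu0 : 0 ≤ wu) (hwu1 : wu ≤ 1) (hws0 : 0 ≤ ws) (hws1 : ws ≤ 1) : 0 ≤ mfCtwoR100 q wg wu ws := by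
  have hq1' : (0:ℝ) ≤ 1 - q := sub_nonneg.2 hq1
  have hwg1' : (0:ℝ) ≤ 1 - wg := sub_nonneg.2 hwg1
  have hwu1' : (0:ℝ) ≤ 1 - wu := sub_nonneg.2 hwu1
  have hws1' : (0:ℝ) ≤ 1 - ws := sub_nonneg.2 hws1
  have e : mfCtwoR100 q wg wu ws =
      (4 : ℝ) * (1 - q) ^ 4 * (1 - wg) ^ 2 * wu ^ 2 * ws ^ 2 + (8 : ℝ) * (1 - q) ^ 4 * wg * (1 - wg) * wu ^ 2 * ws ^ 2 + (4 : ℝ) * (1 - q) ^ 4 * wg ^ 2 * wu ^ 2 * ws ^ 2 +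
      (12 : ℝ) * q * (1 - q) ^ 3 * (1 - wg) ^ 2 * wu ^ 2 * ws ^ 2 + (8 : ℝ) * q * (1 - q) ^ 3 * wg * (1 - wg) * wu ^ 2 * ws * (1 - ws) +
      (32 : ℝ) * q * (1 - q) ^ 3 * wg * (1 - wg) * wu ^ 2 * ws ^ 2 + (4 : ℝ) * q * (1 - q) ^ 3 * wg ^ 2 * (1 - wu) ^ 2 * (1 - ws) ^ 2 +
      (8 : ℝ) * q * (1 - q) ^ 3 * wg ^ 2 * (1 - wu) ^ 2 * ws * (1 - ws) + (8 : ℝ) * q * (1 - q) ^ 3 * wg ^ 2 * wu * (1 - wu) * (1 - ws) ^ 2 +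
      (16 : ℝ) * q * (1 - q) ^ 3 * wg ^ 2 * wu * (1 - wu) * ws * (1 - ws) + (8 : ℝ) * q * (1 - q) ^ 3 * wg ^ 2 * wu ^ 2 * ws * (1 - ws) +
      (16 : ℝ) * q * (1 - q) ^ 3 * wg ^ 2 * wu ^ 2 * ws ^ 2 + (13 : ℝ) * q ^ 2 * (1 - q) ^ 2 * (1 - wg) ^ 2 * wu ^ 2 * ws ^ 2 +
      (12 : ℝ) * q ^ 2 * (1 - q) ^ 2 * wg * (1 - wg) * wu ^ 2 * ws * (1 - ws) + (42 : ℝ) * q ^ 2 * (1 - q) ^ 2 * wg * (1 - wg) * wu ^ 2 * ws ^ 2 +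
      (4 : ℝ) * q ^ 2 * (1 - q) ^ 2 * wg ^ 2 * (1 - wu) ^ 2 * (1 - ws) ^ 2 + (8 : ℝ) * q ^ 2 * (1 - q) ^ 2 * wg ^ 2 * (1 - wu) ^ 2 * ws * (1 - ws) +
      (8 : ℝ) * q ^ 2 * (1 - q) ^ 2 * wg ^ 2 * wu * (1 - wu) * (1 - ws) ^ 2 + (16 : ℝ) * q ^ 2 * (1 - q) ^ 2 * wg ^ 2 * wu * (1 - wu) * ws * (1 - ws) +
      (16 : ℝ) * q ^ 2 * (1 - q) ^ 2 * wg ^ 2 * wu ^ 2 * ws * (1 - ws) + (21 : ℝ) * q ^ 2 * (1 - q) ^ 2 * wg ^ 2 * wu ^ 2 * ws ^ 2 +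
      (6 : ℝ) * q ^ 3 * (1 - q) * (1 - wg) ^ 2 * wu ^ 2 * ws ^ 2 + (4 : ℝ) * q ^ 3 * (1 - q) * wg * (1 - wg) * wu ^ 2 * ws * (1 - ws) +
      (22 : ℝ) * q ^ 3 * (1 - q) * wg * (1 - wg) * wu ^ 2 * ws ^ 2 + (1 : ℝ) * q ^ 3 * (1 - q) * wg ^ 2 * (1 - wu) ^ 2 * (1 - ws) ^ 2 +
      (2 : ℝ) * q ^ 3 * (1 - q) * wg ^ 2 * (1 - wu) ^ 2 * ws * (1 - ws) + (2 : ℝ) * q ^ 3 * (1 - q) * wg ^ 2 * wu * (1 - wu) * (1 - ws) ^ 2 +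
      (4 : ℝ) * q ^ 3 * (1 - q) * wg ^ 2 * wu * (1 - wu) * ws * (1 - ws) + (10 : ℝ) * q ^ 3 * (1 - q) * wg ^ 2 * wu ^ 2 * ws * (1 - ws) +
      (11 : ℝ) * q ^ 3 * (1 - q) * wg ^ 2 * wu ^ 2 * ws ^ 2 + (1 : ℝ) * q ^ 4 * (1 - wg) ^ 2 * wu ^ 2 * ws ^ 2 + (4 : ℝ) * q ^ 4 * wg * (1 - wg) * wu ^ 2 * ws ^ 2 +
      (2 : ℝ) * q ^ 4 * wg ^ 2 * wu ^ 2 * ws * (1 - ws) + (2 : ℝ) * q ^ 4 * wg ^ 2 * wu ^ 2 * ws ^ 2 := by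
    simp only [mfCtwoR100]; ring
  rw [e]; positivity

set_option maxHeartbeats 1500000 in
/-- `mfCtwoR101 ≥ 0` on the box `q, w_g, w_u, w_s ∈ [0,1]` (explicit non-negative certificate, checked by `ring` + `positivity`). [folklore] -/
theorem mfCtwoR101_nonneg {q wg wu ws : ℝ} (hq0 : 0 ≤ q) (hq1 : q ≤ 1) (hwg0 : 0 ≤ wg) (hwg1 : wg ≤ 1) (hwu0 : 0 ≤ wu) (hwu1 : wu ≤ 1) (hws0 : 0 ≤ ws) (hws1 : ws ≤ 1) : 0 ≤ mfCtwoR101 q wg wu ws := by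
  have hq1' : (0:ℝ) ≤ 1 - q := sub_nonneg.2 hq1
  have hwg1' : (0:ℝ) ≤ 1 - wg := sub_nonneg.2 hwg1
  have hwu1' : (0:ℝ) ≤ 1 - wu := sub_nonneg.2 hwu1
  have hws1' : (0:ℝ) ≤ 1 - ws := sub_nonneg.2 hws1
  have e : mfCtwoR101 q wg wu ws =
      (4 : ℝ) * q * (1 - q) ^ 3 * (1 - wg) ^ 2 * wu ^ 2 * ws ^ 2 + (8 : ℝ) * q * (1 - q) ^ 3 * wg * (1 - wg) * wu ^ 2 * ws * (1 - ws) +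
      (16 : ℝ) * q * (1 - q) ^ 3 * wg * (1 - wg) * wu ^ 2 * ws ^ 2 + (8 : ℝ) * q * (1 - q) ^ 3 * wg ^ 2 * (1 - wu) ^ 2 * (1 - ws) ^ 2 +
      (16 : ℝ) * q * (1 - q) ^ 3 * wg ^ 2 * (1 - wu) ^ 2 * ws * (1 - ws) + (4 : ℝ) * q * (1 - q) ^ 3 * wg ^ 2 * (1 - wu) ^ 2 * ws ^ 2 +
      (16 : ℝ) * q * (1 - q) ^ 3 * wg ^ 2 * wu * (1 - wu) * (1 - ws) ^ 2 + (32 : ℝ) * q * (1 - q) ^ 3 * wg ^ 2 * wu * (1 - wu) * ws * (1 - ws) +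
      (8 : ℝ) * q * (1 - q) ^ 3 * wg ^ 2 * wu * (1 - wu) * ws ^ 2 + (4 : ℝ) * q * (1 - q) ^ 3 * wg ^ 2 * wu ^ 2 * (1 - ws) ^ 2 +
      (16 : ℝ) * q * (1 - q) ^ 3 * wg ^ 2 * wu ^ 2 * ws * (1 - ws) + (12 : ℝ) * q * (1 - q) ^ 3 * wg ^ 2 * wu ^ 2 * ws ^ 2 +
      (8 : ℝ) * q ^ 2 * (1 - q) ^ 2 * (1 - wg) ^ 2 * wu ^ 2 * ws ^ 2 + (12 : ℝ) * q ^ 2 * (1 - q) ^ 2 * wg * (1 - wg) * wu ^ 2 * ws * (1 - ws) +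
      (32 : ℝ) * q ^ 2 * (1 - q) ^ 2 * wg * (1 - wg) * wu ^ 2 * ws ^ 2 + (8 : ℝ) * q ^ 2 * (1 - q) ^ 2 * wg ^ 2 * (1 - wu) ^ 2 * (1 - ws) ^ 2 +
      (16 : ℝ) * q ^ 2 * (1 - q) ^ 2 * wg ^ 2 * (1 - wu) ^ 2 * ws * (1 - ws) + (4 : ℝ) * q ^ 2 * (1 - q) ^ 2 * wg ^ 2 * (1 - wu) ^ 2 * ws ^ 2 +
      (16 : ℝ) * q ^ 2 * (1 - q) ^ 2 * wg ^ 2 * wu * (1 - wu) * (1 - ws) ^ 2 + (32 : ℝ) * q ^ 2 * (1 - q) ^ 2 * wg ^ 2 * wu * (1 - wu) * ws * (1 - ws) +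
      (8 : ℝ) * q ^ 2 * (1 - q) ^ 2 * wg ^ 2 * wu * (1 - wu) * ws ^ 2 + (8 : ℝ) * q ^ 2 * (1 - q) ^ 2 * wg ^ 2 * wu ^ 2 * (1 - ws) ^ 2 +
      (32 : ℝ) * q ^ 2 * (1 - q) ^ 2 * wg ^ 2 * wu ^ 2 * ws * (1 - ws) + (24 : ℝ) * q ^ 2 * (1 - q) ^ 2 * wg ^ 2 * wu ^ 2 * ws ^ 2 +
      (5 : ℝ) * q ^ 3 * (1 - q) * (1 - wg) ^ 2 * wu ^ 2 * ws ^ 2 + (4 : ℝ) * q ^ 3 * (1 - q) * wg * (1 - wg) * wu ^ 2 * ws * (1 - ws) +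
      (20 : ℝ) * q ^ 3 * (1 - q) * wg * (1 - wg) * wu ^ 2 * ws ^ 2 + (2 : ℝ) * q ^ 3 * (1 - q) * wg ^ 2 * (1 - wu) ^ 2 * (1 - ws) ^ 2 +
      (4 : ℝ) * q ^ 3 * (1 - q) * wg ^ 2 * (1 - wu) ^ 2 * ws * (1 - ws) + (1 : ℝ) * q ^ 3 * (1 - q) * wg ^ 2 * (1 - wu) ^ 2 * ws ^ 2 +
      (4 : ℝ) * q ^ 3 * (1 - q) * wg ^ 2 * wu * (1 - wu) * (1 - ws) ^ 2 + (8 : ℝ) * q ^ 3 * (1 - q) * wg ^ 2 * wu * (1 - wu) * ws * (1 - ws) +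
      (2 : ℝ) * q ^ 3 * (1 - q) * wg ^ 2 * wu * (1 - wu) * ws ^ 2 + (5 : ℝ) * q ^ 3 * (1 - q) * wg ^ 2 * wu ^ 2 * (1 - ws) ^ 2 +
      (20 : ℝ) * q ^ 3 * (1 - q) * wg ^ 2 * wu ^ 2 * ws * (1 - ws) + (15 : ℝ) * q ^ 3 * (1 - q) * wg ^ 2 * wu ^ 2 * ws ^ 2 + (1 : ℝ) * q ^ 4 * (1 - wg) ^ 2 * wu ^ 2 * ws ^ 2 +
      (4 : ℝ) * q ^ 4 * wg * (1 - wg) * wu ^ 2 * ws ^ 2 + (1 : ℝ) * q ^ 4 * wg ^ 2 * wu ^ 2 * (1 - ws) ^ 2 + (4 : ℝ) * q ^ 4 * wg ^ 2 * wu ^ 2 * ws * (1 - ws) +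
      (3 : ℝ) * q ^ 4 * wg ^ 2 * wu ^ 2 * ws ^ 2 := by
    simp only [mfCtwoR101]; ring
  rw [e]; positivity

set_option maxHeartbeats 1500000 in
/-- `mfCtwoR102 ≥ 0` on the box `q, w_g, w_u, w_s ∈ [0,1]` (explicit non-negative certificate, checked by `ring` + `positivity`). [folklore] -/
theorem mfCtwoR102_nonneg {q wg wu : ℝ} (hq0 : 0 ≤ q) (hq1 : q ≤ 1) (hwu0 : 0 ≤ wu) (hwu1 : wu ≤ 1) : 0 ≤ mfCtwoR102 q wg wu := by
  have hq1' : (0:ℝ) ≤ 1 - q := sub_nonneg.2 hq1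
  have hwu1' : (0:ℝ) ≤ 1 - wu := sub_nonneg.2 hwu1
  have e : mfCtwoR102 q wg wu =
      (4 : ℝ) * q ^ 2 * (1 - q) ^ 2 * wg ^ 2 * wu ^ 2 + (1 : ℝ) * q ^ 3 * (1 - q) * wg ^ 2 * (1 - wu) ^ 2 + (2 : ℝ) * q ^ 3 * (1 - q) * wg ^ 2 * wu * (1 - wu) +
      (5 : ℝ) * q ^ 3 * (1 - q) * wg ^ 2 * wu ^ 2 + (1 : ℝ) * q ^ 4 * wg ^ 2 * wu ^ 2 := by
    simp only [mfCtwoR102]; ring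
  rw [e]; positivity


end ThreeApex

end FK

end Summit.CriticalPhenomena.PercolationContinuityZ3.Theorems
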